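import Summits.ABC.ABC.Theses.IUTThetaPilot
import Literature.IUT.LogVolume.Corollary22PartII
import Literature.IUT.LogVolume.Corollary22GaloisImage
import Literature.IUT.LogVolume.PrimeNumberEstimates
import HarnessLib

set_option linter.dupNamespace false

/-!
# Route `route-ABC-IUTThetaPilot`, crux `ThetaPartII` (stmt-ABC-19678) — REDUCED to the single named
# disputed input `Cor22.Thm110Legendre` (conditional result)

The route file `Summits/ABC/ABC/Theses/IUTThetaPilot.lean` (abc-iut-plan gen 5, 2026-08-25) carries the crux

  `ThetaPartII : Prop := ∃ HII : ℝ, ∀ D : GenEll.CBData, Cor22.Hypotheses D → Cor22.PartII D HII`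

— [IUTchIV] Corollary 2.2 (ii), uniform in the compactly bounded subset (S. Mochizuki, *Inter-universal
Teichmüller theory IV*, kurims manuscript (Apr. 2020), Cor. 2.2, statement pp. 41–43, proof pp. 43–48).
The printed proof of (ii) has ONE non-classical step: "(P7) … In light of (P7), we may apply Theorem 1.10"
(p. 46) — the existence of initial Θ-data for the Legendre curve and the first display of Thm. 1.10 for them,
which rests on [IUTchIII] Cor. 3.12 (DISPUTED). abc-iut-S-d2 typed exactly that step as the named hypothesis
`Literature.IUT.LogVolume.Cor22.Thm110Legendre` (`Corollary22Legendre.lean`), and everything else in the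
printed proof is PROVED in the tree: the assembly `Cor22.partII_of_thm110Legendre` /
`Cor22.exists_partII_of_thm110Legendre` (abc-iut-S3, `Corollary22PartII.lean`, p410641: exceptional set via
Northcott and Cor. 2.2 (i), prime choice (P1)–(P3), (P5), arithmetic pp. 46–48), and the classical
Galois-image input (P4) ⟹ (P6) `Cor22.fullGaloisImage_holds : Cor22.FullGaloisImage` (abc-iut-S-d2 /
abc-iut-S-d1 / abc-iut-S-d4 / abc-iut-S5, `Corollary22GaloisImage.lean`: [GenEll] Lemma 3.5, Prop. 3.4,
Lemma 3.1 (iii), Tate curve).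

Hence this file: **the crux holds as soon as `Thm110Legendre` does** — a CONDITIONAL result (the item stays
open: its own signature is not proved; the named fact is the only remaining input, and it is the disputed
one). HONEST FRAMING: nothing here asserts [IUTchIV] Thm. 1.10, [IUTchIII] Cor. 3.12, or abc; the theorem
makes kernel-precise that route-ABC-IUTThetaPilot's crux IS, modulo proved classical mathematics, exactly the
Thm 1.10 display for Legendre curves with admissible `l`. [claim: Mochizuki2012, status: disputed] for the
IUT sentences quoted.
-/

namespace Summit.ABC.ABC.Theorems

/-- **stmt-ABC-19678 `ThetaPartII` modulo `Cor22.Thm110Legendre`** (route-ABC-IUTThetaPilot, crux, rank 2):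
[IUTchIV] Cor. 2.2 (ii) uniform — `Summit.ABC.ABC.Theses.IUTThetaPilot.ThetaPartII` — follows from the named
hypothesis `Literature.IUT.LogVolume.Cor22.Thm110Legendre` ("(P7) + Theorem 1.10" for Legendre curves, p. 46;
rests on [IUTchIII] Cor. 3.12, disputed), by the tree's `Cor22.exists_partII_of_thm110Legendre` (the printed
proof pp. 43–48) and `Cor22.fullGaloisImage_holds` (the classical (P4) ⟹ (P6) input, proved). CONDITIONAL on
that one named fact; never asserted unconditionally. [cite: Mochizuki2012, IUTchIV Cor. 2.2 (ii) pp.41–48] -/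
theorem ThetaPartII_of_thm110Legendre (h110 : Literature.IUT.LogVolume.Cor22.Thm110Legendre) :
    Summit.ABC.ABC.Theses.IUTThetaPilot.ThetaPartII := by
  unfold Summit.ABC.ABC.Theses.IUTThetaPilot.ThetaPartII
  exact Literature.IUT.LogVolume.Cor22.exists_partII_of_thm110Legendre h110
    Literature.IUT.LogVolume.Cor22.fullGaloisImage_holds

/-- **The registered stub `stub_theta` of the crux's birth skeleton, modulo `Cor22.Thm110Legendre`**: for
every compactly bounded `K_V` (hypotheses of Cor. 2.2) there are `C_K, H_K > 0` such that every point of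
`K_V ∩ U_X(ℚ̄)^{≤d}` with `log(q^∀) > H_II·ε_d^{−3}·d^{4+ε_d} + H_K` (`H_II = 2^140`) admits a prime `l ≥ 5`
with (C1), (C2) ([IUTchIV] Cor. 2.2 (ii), pp. 42–43) — read off `Cor22.partII_of_thm110Legendre`: such a point
lies outside the exceptional set `Exc_d`, on which `log(q^∀)` is bounded by that quantity. CONDITIONAL on the
named disputed fact; the stub itself (unconditional) is not claimed. [cite: Mochizuki2012, IUTchIV Cor. 2.2 (ii) pp.41–48] -/
theorem stub_theta_of_thm110Legendre (h110 : Literature.IUT.LogVolume.Cor22.Thm110Legendre) :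
    ∃ HII : ℝ, 0 ≤ HII ∧ ∀ D : Literature.NumberTheory.DiophantineGeometry.GenEll.CBData,
      Literature.IUT.LogVolume.Cor22.Hypotheses D → ∃ CK HK : ℝ, 0 < CK ∧ 0 < HK ∧
        ∀ d : ℕ, 1 ≤ d → ∀ εd : ℝ, 0 < εd → εd ≤ 1 →
          ∀ P ∈ D.toSet ∩ Literature.NumberTheory.DiophantineGeometry.GenEll.UPle d,
            HII * εd ^ (-(3 : ℝ)) * (d : ℝ) ^ (4 + εd) + HK < Literature.IUT.LogVolume.Cor22.logQForall P →
              ∃ l : ℕ, l.Prime ∧ 5 ≤ l ∧ Literature.IUT.LogVolume.Cor22.ConditionsC1C2 d CK P l := by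
  obtain ⟨η, hη⟩ := Literature.IUT.LogVolume.exists_isEtaPrm
  refine ⟨2 ^ 140, by positivity, fun D hD => ?_⟩
  obtain ⟨CK, HK, hCK, hHK, hmain⟩ :=
    Literature.IUT.LogVolume.Cor22.partII_of_thm110Legendre h110
      Literature.IUT.LogVolume.Cor22.fullGaloisImage_holds hη D hD
  refine ⟨CK, HK, hCK, hHK, fun d hd εd hε0 hε1 P hP hbig => ?_⟩
  obtain ⟨Exc, -, -, -, hbound, hoff⟩ := hmain d hd εd hε0 hε1
  have hnot : P ∉ Exc := fun hmem => absurd (hbound P hmem) (not_le.mpr hbig)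
  obtain ⟨l, hlp, h5, hC⟩ := hoff P hP hnot
  exact ⟨l, hlp, h5, hC⟩

end Summit.ABC.ABC.Theorems
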